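import Summits.ResolutionOfSingularities.ResolutionOfSingularities.Theorems.FrobeniusLadderFRationalResolutionFRationalSurfaceLocal
import Summits.ResolutionOfSingularities.ResolutionOfSingularities.Theorems.FrobeniusLadderFRationalResolutionResolutionRestrict
import Summits.ResolutionOfSingularities.ResolutionOfSingularities.Theorems.FrobeniusLadderFRationalResolutionAnResolutionStep
import HarnessLib

/-!
# F-rational surfaces with `A_n` charts at their singular points are resolvable

Support file for crux stmt-ResolutionOfSingularities-15317 (`FrobeniusLadder.FRationalResolution`),
line `Sketch`, continuation seat c3 — the SHOWCASE of theme L (local-to-global) + the `A_n` tower: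
an integral F-rational surface `X/k` each of whose (finitely many) singular points has a Zariski
neighbourhood that is an open neighbourhood of the origin of some `A_n = Spec k[y,z,x]/(yz + x^(n+1))`
(compatibly with the regular locus) HAS A RESOLUTION OF SINGULARITIES — unconditionally, every
field, every characteristic: the global tower model of `A_n` (`An_offOrigin_resolution`) restricts to
the neighbourhood (`stub_offLocus_resolution_restrict`, p149210) and the local resolutions glue
(`hasResolution_fRational_surface_of_local`, over `stub_hasResolution_of_local_resolutions` p149060).
[folklore]
-/

-- single-problem summit: the doubled namespace component is forced
set_option linter.dupNamespace false

noncomputable section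

namespace Summit.ResolutionOfSingularities.ResolutionOfSingularities.Theorems.FRationalResolution

open CategoryTheory AlgebraicGeometry TopologicalSpace MvPolynomial
open Literature.AlgebraicGeometry.Resolution

/-- **F-RATIONAL SURFACES WITH `A_n` CHARTS ARE RESOLVABLE.** Let `X` be an integral `k`-scheme of
finite type over a field `k` of characteristic `p`, of dimension `≤ 2`, whose stalks satisfy the
F-rational clause of `FRationalResolution`. Suppose every singular point `s` has an open neighbourhood
`V`, containing no other singular point, with an open immersion `j : V → A_n = Spec k[y,z,x]/(yz + x^(n+1))`
(some `n`) under which the complement of the origin pulls back to `V ∩ Reg X`. Then `X` has a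
resolution of singularities. [folklore; Kollár 2007 §2.2, Lipman 1978 §2] -/
theorem hasResolution_fRational_surface_of_An_charts (p : ℕ) (hp : p.Prime) (k : Type) [Field k]
    [CharP k p] (X : Scheme.{0}) [IsIntegral X] (f : X ⟶ Spec (.of k)) [LocallyOfFiniteType f]
    [QuasiCompact f]
    (hFR : ∀ x : X, IsDomain (X.presheaf.stalk x) ∧ ∀ d : ℕ, ringKrullDim (X.presheaf.stalk x) = d →
      ∀ s : Fin d → X.presheaf.stalk x, (Ideal.span (Set.range s)).radical.IsMaximal →
      ∀ y c : X.presheaf.stalk x, c ≠ 0 →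
      (∀ e : ℕ, c * y ^ p ^ e ∈ Ideal.span ((fun z : X.presheaf.stalk x => z ^ p ^ e) ''
        (Ideal.span (Set.range s) : Set (X.presheaf.stalk x)))) → y ∈ Ideal.span (Set.range s))
    (hdim : topologicalKrullDim X ≤ 2)
    (hchart : ∀ s : X, s ∉ Scheme.regularLocus X → ∃ (V : X.Opens) (n : ℕ)
      (j : (V : Scheme.{0}) ⟶ Spec (CommRingCat.of (MvPolynomial (Fin 2 ⊕ Fin 1) k ⧸ Ideal.span
        {(MvPolynomial.X (Sum.inl 0) * MvPolynomial.X (Sum.inl 1) +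
          MvPolynomial.rename Sum.inr (MvPolynomial.X 0 ^ (n + 1)) : MvPolynomial (Fin 2 ⊕ Fin 1) k)}))),
      s ∈ V ∧ (∀ t : X, t ∉ Scheme.regularLocus X → t ∈ V → t = s) ∧ IsOpenImmersion j ∧
      j ⁻¹ᵁ ((PrimeSpectrum.basicOpen (Ideal.Quotient.mk _ (MvPolynomial.X (Sum.inl 0))) ⊔
          PrimeSpectrum.basicOpen (Ideal.Quotient.mk _ (MvPolynomial.X (Sum.inl 1))) ⊔
          PrimeSpectrum.basicOpen (Ideal.Quotient.mk _ (MvPolynomial.X (Sum.inr 0)))) :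
            (Spec (CommRingCat.of (MvPolynomial (Fin 2 ⊕ Fin 1) k ⧸ Ideal.span
              {(MvPolynomial.X (Sum.inl 0) * MvPolynomial.X (Sum.inl 1) +
                MvPolynomial.rename Sum.inr (MvPolynomial.X 0 ^ (n + 1)) :
                  MvPolynomial (Fin 2 ⊕ Fin 1) k)}))).Opens) =
        V.ι ⁻¹ᵁ ⟨Scheme.regularLocus X, isOpen_regularLocus_of_locallyOfFiniteType_field f⟩) :
    Scheme.HasResolution X := by
  refine hasResolution_fRational_surface_of_local p hp k X f hFR hdim fun s hs => ?_
  obtain ⟨V, n, j, hsV, hVS, hj, hjU⟩ := hchart s hs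
  haveI := hj
  obtain ⟨Y, ρ, hρ, hY, hiso, hd⟩ := stub_offLocus_resolution_restrict _ _ j _
    (An_offOrigin_resolution k n)
  rw [hjU] at hiso hd
  exact ⟨V, hsV, hVS, Y, ρ, hρ, hY, hiso, hd⟩

end Summit.ResolutionOfSingularities.ResolutionOfSingularities.Theorems.FRationalResolution

end
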